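import Summits.NavierStokesRegularity.TurbBounds.FSU1.Corner
import Summits.NavierStokesRegularity.TurbBounds.FSU1.Mode.M03Defs
import Summits.NavierStokesRegularity.TurbBounds.FSU1.Mode.M06PhiRegime
import Summits.NavierStokesRegularity.TurbBounds.FSU1.Mode.M15Scalar
import Summits.NavierStokesRegularity.TurbBounds.FSU1.Mode.M16CellPackage

/-!
# FS-U1″ mode lemma — EdgePackage (`TurbBounds/FSU1/Mode/M17EdgePackage.lean`)

The corner (edge) scalar package `edge_scalars`.

Cell-made mathematics of FS-PROOF-DRAFT §3 (pub-turb-sos), kernel-checked; generated from the design compose file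
`StageF_compose.check.lean` (96c4b9bf…) by `build_mode_split.py`.  HONEST FRAMING: rigorous bounds for the stated PDE and boundary conditions; no claim about physical turbulence beyond the bound.
-/

open Real intervalIntegral MeasureTheory Set

namespace Summit.NavierStokesRegularity.TurbBounds.FSU1.Mode

open Summit.NavierStokesRegularity.TurbBounds.SpectralFormFreeSlip
open Summit.NavierStokesRegularity.TurbBounds.FSU1

/-- CORNER scalar package: the same data on the corner region `κ > κ_I`, `kδ < ρ_I`, from `CornerIneq`. -/
theorem edge_scalars (p : Params) (hS : ScalarLines p) {y k : ℝ} (hy : 0 < y) (hy2 : 10 ≤ y ^ 2) (hk : 0 < k)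
    {eps : ℚ} (hcor : CornerIneq p eps) (hkI : (p.kapI:ℝ) < k / y ^ 3)
    (hρI : k * ((p.D:ℝ) / y ^ 5) < p.rhoI) (hH : MajorH) (hJ : MajorJ) :
    SchurData ((p.a:ℝ) / y ^ 18) ((p.bp:ℝ) / y ^ 12) ((p.D:ℝ) / y ^ 5) k (Fedge p * Phi p p.kapI / y ^ 15) eps := by
  unfold SchurData
  obtain ⟨ha, hbp, hc, hD, hkapI, hρI1, hρIe, hk2, hbpk, hcdef, hD12, hkc3⟩ := scalar_basics p hS
  obtain ⟨he0, he1, hFe, hPhiI, hineq⟩ := hcor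
  have he0R : (0:ℝ) < eps := by exact_mod_cast he0
  have he1R : (eps:ℝ) < 1 := by exact_mod_cast he1
  have hy3 : R4 ≤ y ^ 3 := R4_le_cube hy hy2
  have hM := Mhalf_scaled p ha hc hy hk
  have hmt := mtR_scaled p ha hc hy hk
  have hP := Pof_scaled p ha hy hk
  have hQ := Qof_scaled p ha hy hk
  set α : ℝ := (p.a:ℝ) / y ^ 18 with hαdef
  set β₀ : ℝ := (p.bp:ℝ) / y ^ 12 with hβdef
  set δ : ℝ := (p.D:ℝ) / y ^ 5 with hδdef
  set σ : ℝ := Fedge p * Phi p p.kapI / y ^ 15 with hσdef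
  set κ : ℝ := k / y ^ 3 with hκdef
  set κI : ℝ := ((p.kapI:ℚ):ℝ) with hκIdef
  have hκ0 : 0 < κ := by rw [hκdef]; positivity
  have hκIκ : κI ≤ κ := hkI.le
  have hkκ : k = κ * y ^ 3 := by rw [hκdef]; field_simp
  set s : ℝ := Real.sqrt (κ ^ 2 + (p.c:ℝ)) with hsdef
  obtain ⟨hs0, hssq, hκs, -⟩ := sqrt_facts hc hκ0.le
  have hPhi : 0 < Phi p κ := by unfold Phi; positivity
  have hkc0 : 0 < kc p := by unfold kc; positivity
  have hsk0 : 0 < Real.sinh (kc p) := Real.sinh_pos_iff.mpr hkc0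
  have hekc := Real.exp_pos (-kc p)
  have hmt0 : 0 ≤ mt p p.kapI := by unfold mt; exact Real.sqrt_nonneg _
  have hFe1 : Fedge p ≤ 1 := by
    have hden : 0 < 1 + 2 * Real.exp (-kc p) * kc p * (mt p p.kapI + 1) ^ 2 * (p.kapI:ℝ) ^ 2 / p.c
        + 4 * (mt p p.kapI + 1) * (p.kapI:ℝ) ^ 2 / ((p.c:ℝ) * Real.sinh (kc p)) := by positivity
    have hnum : 0 ≤ 2 * Real.exp (-kc p) * kc p * (mt p p.kapI + 1) ^ 2 * (p.kapI:ℝ) ^ 2 / p.c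
        + 4 * (mt p p.kapI + 1) * (p.kapI:ℝ) ^ 2 / ((p.c:ℝ) * Real.sinh (kc p)) := by positivity
    unfold Fedge; rw [div_le_one hden]
    linarith only [hnum]
  have hσ : 0 < σ := by rw [hσdef]; positivity
  have hσM : σ * Mhalf α β₀ k = Fedge p * (Phi p κI / Phi p κ) := by rw [hM, hσdef]; field_simp
  have hq : Phi p κI / Phi p κ ≤ 1 := by
    rw [div_le_one hPhi, Phi_eq_phiR, Phi_eq_phiR]
    exact phiR_mono_right ha hc hkapI hκIκ hk2
  have hq0 : 0 ≤ Phi p κI / Phi p κ := by positivity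
  -- edge geometry: `10 κ ≤ κ_I y²`
  have hedge : 10 * κ ≤ κI * y ^ 2 := by
    have h1 : k * δ = κ * (p.D:ℝ) / y ^ 2 := by rw [hδdef, hkκ]; field_simp; try ring
    have h2 := hρI
    rw [h1, hρIe, div_lt_div_iff₀ (by positivity) (by norm_num)] at h2
    have h3 : (p.D:ℝ) * (10 * κ) < (p.D:ℝ) * (κI * y ^ 2) := by linarith only [h2]
    exact (lt_of_mul_lt_mul_left h3 hD.le).le
  -- bracket
  have hκs' : κ ≤ s := by rw [hsdef]; exact hκs.le
  have hPk : k ≤ Pof α β₀ k := by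
    rw [hP, hkκ]
    have h := mul_le_mul_of_nonneg_right hκs' (pow_pos hy 3).le
    linarith only [h]
  have hQ0 : 0 ≤ Qof α β₀ k := by
    rw [hQ]; have h : 0 ≤ s - κ := sub_nonneg.mpr hκs'; positivity
  have hε1 : eps1 α β₀ k ≤ 2 / Real.sinh (κ * y ^ 3) := by
    unfold eps1; rw [← hkκ]; exact eps1_le_edge hk hPk hQ0
  have hg : gplus k ≤ 2 * (κ * y ^ 3) * Real.exp (-(κ * y ^ 3)) := by rw [← hkκ]; exact gplus_le_lin hk
  have hkc95 : 9 / 5 ≤ κI * R4 := by linarith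
  have hbr : evenBracket α β₀ k ≤ 1 / Fedge p := by
    unfold evenBracket; rw [hmt]; unfold Fedge; rw [one_div_one_div]; unfold mt kc
    exact edge_bracket_le hc hkapI hκIκ hy hy3 hkc95 hedge hg hε1
  have hii : σ * Mhalf α β₀ k * evenBracket α β₀ k ≤ 1 := by
    rw [hσM]
    by_cases hb : evenBracket α β₀ k ≤ 0
    · have : 0 ≤ Fedge p * (Phi p κI / Phi p κ) := by positivity
      exact le_trans (mul_nonpos_of_nonneg_of_nonpos this hb) zero_le_one
    · push Not at hb
      calc Fedge p * (Phi p κI / Phi p κ) * evenBracket α β₀ k ≤ Fedge p * 1 * evenBracket α β₀ k := by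
            apply mul_le_mul_of_nonneg_right _ hb.le
            exact mul_le_mul_of_nonneg_left hq hFe.le
        _ ≤ Fedge p * (1 / Fedge p) := by rw [mul_one]; exact mul_le_mul_of_nonneg_left hbr hFe.le
        _ = 1 := by field_simp
  have hiii : σ * Mhalf α β₀ k ≤ 1 := by
    rw [hσM]
    calc Fedge p * (Phi p κI / Phi p κ) ≤ 1 * 1 := mul_le_mul hFe1 hq hq0 zero_le_one
      _ = 1 := by ring
  -- Schur condition
  have hδ0 : 0 < δ := by rw [hδdef]; positivity
  set ρ : ℝ := k * δ with hρdef
  have hρκ : ρ = κ * (p.D:ℝ) / y ^ 2 := by rw [hρdef, hδdef, hkκ]; field_simp; try ring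
  have hρ0 : 0 ≤ ρ := by rw [hρdef]; positivity
  have hρle : ρ ≤ (p.rhoI:ℝ) := hρI.le
  have hρ1 : ρ ≤ 1 := le_trans hρle hρI1
  have hHb : HnormSq ρ ≤ PH (p.rhoI:ℝ) := le_trans (hH ρ hρ0 hρ1) (PH_mono hρ0 hρle)
  have hJb : Jfun ρ ≤ ρ ^ 4 * PJ (p.rhoI:ℝ) :=
    le_trans (hJ ρ hρ0 hρ1) (mul_le_mul_of_nonneg_left (PJ_mono hρ0 hρle) (by positivity))
  have h1e : 0 < 1 - (eps:ℝ) := by linarith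
  have hB1 : (Real.sqrt (δ ^ 3 * HnormSq (k * δ)) / 2) ^ 2 / ((1 - eps) * σ)
      ≤ (1 / 4 : ℝ) * (p.D : ℝ) ^ 3 * PH p.rhoI / (Fedge p * Phi p p.kapI) / (1 - eps) := by
    rw [div_pow, Real.sq_sqrt (mul_nonneg (pow_nonneg hδ0.le 3) (HnormSq_nonneg _))]
    have e : (1 / 4 : ℝ) * (p.D : ℝ) ^ 3 * PH p.rhoI / (Fedge p * Phi p p.kapI) / (1 - eps)
        = δ ^ 3 * PH (p.rhoI:ℝ) / 2 ^ 2 / ((1 - eps) * σ) := by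
      rw [hσdef, hδdef, hκIdef]; field_simp; ring
    rw [e]
    apply div_le_div_of_nonneg_right _ (by positivity)
    apply div_le_div_of_nonneg_right _ (by positivity)
    exact mul_le_mul_of_nonneg_left hHb (by positivity)
  set ν : ℝ := α * (π ^ 2 / (4 * δ ^ 2)) + (α * k ^ 2 + β₀) with hνdef
  have hν : 0 < ν := by rw [hνdef, hαdef, hβdef, hδdef]; positivity
  set Den : ℝ := (p.a:ℝ) * π ^ 2 * y ^ 4 / (4 * (p.D:ℝ) ^ 2) + (p.a:ℝ) * κ ^ 2 + (p.bp:ℝ) with hDendef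
  have hrat : ρ ^ 4 / (k ^ 2 * ν) = κ ^ 2 * (p.D:ℝ) ^ 4 / (y ^ 2 * Den) := by
    rw [hρdef, hνdef, hDendef, hαdef, hβdef, hδdef, hkκ]
    field_simp; ring
  -- lower bound for `Den` using `y⁴ ≥ 100 κ²/κ_I²`
  set A2 : ℝ := (p.a:ℝ) * π ^ 2 * 100 / (4 * (p.D:ℝ) ^ 2 * κI ^ 2) + (p.a:ℝ) with hA2
  have hA2pos : 0 < A2 := by rw [hA2]; positivity
  have hy4 : 100 * κ ^ 2 ≤ κI ^ 2 * y ^ 4 := by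
    have h := pow_le_pow_left₀ (by positivity : (0:ℝ) ≤ 10 * κ) hedge 2; linarith only [h]
  have hDenlb : κ ^ 2 * A2 + (p.bp:ℝ) ≤ Den := by
    rw [hDendef, hA2]
    have : (p.a:ℝ) * π ^ 2 * 100 / (4 * (p.D:ℝ) ^ 2 * κI ^ 2) * κ ^ 2
        ≤ (p.a:ℝ) * π ^ 2 * y ^ 4 / (4 * (p.D:ℝ) ^ 2) := by
      rw [div_mul_eq_mul_div, div_le_div_iff₀ (by positivity) (by positivity)]
      have h0 : 0 ≤ (p.a:ℝ) * π ^ 2 * (4 * (p.D:ℝ) ^ 2) := by positivity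
      linarith only [mul_le_mul_of_nonneg_left hy4 h0]
    linarith only [this]
  have hlbpos : 0 < κ ^ 2 * A2 + (p.bp:ℝ) := by positivity
  -- `1/y² ≤ κ_I/(10 κ)`
  have hyinv : κ ^ 2 * (p.D:ℝ) ^ 4 / (y ^ 2 * Den) ≤ κ * κI * (p.D:ℝ) ^ 4 / (10 * (κ ^ 2 * A2 + (p.bp:ℝ))) := by
    rw [div_le_div_iff₀ (by positivity) (by positivity)]
    have hDenpos : 0 < Den := lt_of_lt_of_le hlbpos hDenlb
    have h1 : κ ^ 2 * (p.D:ℝ) ^ 4 * (10 * (κ ^ 2 * A2 + (p.bp:ℝ))) ≤ κ ^ 2 * (p.D:ℝ) ^ 4 * (10 * Den) := by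
      apply mul_le_mul_of_nonneg_left _ (by positivity); linarith
    have h2 : κ ^ 2 * (p.D:ℝ) ^ 4 * (10 * Den) = (10 * κ) * (κ * (p.D:ℝ) ^ 4 * Den) := by ring
    have h3 : (10 * κ) * (κ * (p.D:ℝ) ^ 4 * Den) ≤ (κI * y ^ 2) * (κ * (p.D:ℝ) ^ 4 * Den) :=
      mul_le_mul_of_nonneg_right hedge (by positivity)
    linarith only [h1, h2, h3]
  -- monotone decrease in `κ ≥ κ_I` (uses `bp ≤ A2 κ_I²`)
  have hbpA : (p.bp:ℝ) ≤ A2 * κI ^ 2 := by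
    rw [hA2]
    have e : ((p.a:ℝ) * π ^ 2 * 100 / (4 * (p.D:ℝ) ^ 2 * κI ^ 2) + (p.a:ℝ)) * κI ^ 2
        = (p.a:ℝ) * κI ^ 2 * (1 + π ^ 2 * 100 / (4 * (κI * (p.D:ℝ)) ^ 2)) := by
      field_simp; ring
    rw [e]; exact hbpk
  have hdec : κ * κI * (p.D:ℝ) ^ 4 / (10 * (κ ^ 2 * A2 + (p.bp:ℝ)))
      ≤ κI ^ 2 * (p.D:ℝ) ^ 4 / (10 * (κI ^ 2 * A2 + (p.bp:ℝ))) := by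
    rw [div_le_div_iff₀ (by positivity) (by positivity)]
    have hkey : κ * (κI ^ 2 * A2 + (p.bp:ℝ)) ≤ κI * (κ ^ 2 * A2 + (p.bp:ℝ)) := by
      have h1 : 0 ≤ κ - κI := by linarith
      have h2 : (p.bp:ℝ) ≤ A2 * κ * κI :=
        le_trans hbpA (by linarith only [mul_le_mul_of_nonneg_left hκIκ (by positivity : 0 ≤ A2 * κI)])
      linarith only [mul_le_mul_of_nonneg_right h2 h1]
    linarith only [mul_le_mul_of_nonneg_left hkey (by positivity : 0 ≤ κI * (p.D:ℝ) ^ 4 * 10)]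
  have hnu : κI ^ 2 * A2 + (p.bp:ℝ) = nuDen p p.kapI := by
    have hk0' : ((p.kapI:ℚ):ℝ) ≠ 0 := by rw [← hκIdef]; exact hkapI.ne'
    unfold nuDen; rw [hA2, hκIdef]; field_simp
  have hrat_le : ρ ^ 4 / (k ^ 2 * ν) ≤ κI ^ 2 * (p.D:ℝ) ^ 4 / (10 * nuDen p p.kapI) := by
    rw [hrat, ← hnu]; exact le_trans hyinv hdec
  have hB2 : (Real.sqrt (Jfun (k * δ)) / k / 2) ^ 2 / (eps * ν) ≤ r2sq p p.kapI p.rhoI / eps := by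
    rw [div_pow, div_pow, Real.sq_sqrt (Jfun_nonneg _)]
    have step1 : Jfun (k * δ) / k ^ 2 / 2 ^ 2 / (eps * ν) ≤ ρ ^ 4 * PJ (p.rhoI:ℝ) / k ^ 2 / 2 ^ 2 / (eps * ν) := by
      apply div_le_div_of_nonneg_right _ (by positivity)
      apply div_le_div_of_nonneg_right _ (by positivity)
      exact div_le_div_of_nonneg_right hJb (by positivity)
    refine le_trans step1 ?_
    have e1 : ρ ^ 4 * PJ (p.rhoI:ℝ) / k ^ 2 / 2 ^ 2 / (eps * ν) = PJ (p.rhoI:ℝ) / (4 * eps) * (ρ ^ 4 / (k ^ 2 * ν)) := by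
      ring
    have hnuD : 0 < nuDen p p.kapI := by rw [← hnu]; positivity
    have e2 : r2sq p p.kapI p.rhoI / eps = PJ (p.rhoI:ℝ) / (4 * eps) * (κI ^ 2 * (p.D:ℝ) ^ 4 / (10 * nuDen p p.kapI)) := by
      unfold r2sq; rw [hκIdef]; field_simp
    rw [e1, e2]
    exact mul_le_mul_of_nonneg_left hrat_le (by have := PJ_nonneg (x := (p.rhoI:ℝ)); positivity)
  refine ⟨hσ, hii, hiii, he0R, he1R, ?_⟩
  calc _ ≤ (1 / 4 : ℝ) * (p.D : ℝ) ^ 3 * PH p.rhoI / (Fedge p * Phi p p.kapI) / (1 - eps)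
        + r2sq p p.kapI p.rhoI / eps := add_le_add hB1 hB2
    _ ≤ 1 := hineq

end Summit.NavierStokesRegularity.TurbBounds.FSU1.Mode
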